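import Summits.PneNP.PneNP.Theorems.ChebyshevTracialDesignJuntaVirtualForm
import Summits.PneNP.PneNP.Theorems.ChebyshevTracialDesignJuntaVirtualPositivity
import Literature.Combinatorics.Optimization.TracialDesignsLowDegree
import HarnessLib

/-!
# Junta virtual positivity, part I: low-degree cut-side factors (the cell's §2.15) modulo Grigoriev's Lemma 1.4

Support file for the crux `TracialDecayExp20` (stmt-PneNP-19878; also `TracialDecay20`, stmt-PneNP-19646)
of route `ChebyshevTracialDesign` — the LOW-DEGREE SECTOR of the virtual-positivity step (cell pnp-psdrank
ROUND-3 §2.14–2.15; the referee's pre-registered check: the SOS-duality step must be CARRIED, the PSD-ness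
of the virtual level must come from Grigoriev's KNAPSACK lemma, not from the MOD-2 degree bound):

* `lowdeg_sum_law`: per perfect matching `M`, for factors `A_U` whose entries are combinations of the
  containment indicators `1[A' ⊆ U]`, `|A'| ≤ k`, and any psd `Y`, the level sums of `tr(A_U A_Uᵀ Y)` are
  `T(N; c, i)·P(c)` with `deg P ≤ 2k` and `P(0) = Σ_{j,l} knapsackForm(…) ≥ 0` — the SOS step
  `tr(A Aᵀ Y) = Σ_{j,l} (Σ_a √Y_{la} A_{aj})²` is explicit (`exists_gram_of_posSemidef`), the positivity is
  `virtualForm_nonneg` (part H) under `Literature.Computability.Complexity.Grigoriev2001_knapsackFormNonneg`;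
* `sum_levelWeight_trace_nonpos_of_lowDegree`: for an exact design of degree `D` on the `t`-cuts,
  `IsLowDegreeU n k A` with `2k ≤ D`, `4k ≤ t`, and ARBITRARY psd `Y`:
  `Σ_U Σ_M levelWeight·tr(A_U A_Uᵀ Y_M) ≤ 0` (conditional on the named fact);
* `designValueNonposLowDegree_of_knapsack : Grigoriev2001_knapsackFormNonneg → DesignValueNonposLowDegree`
  — the tree's named statement `Literature.Combinatorics.Optimization.DesignValueNonposLowDegree`
  (TracialDesignsLowDegree.lean, p408849) with `c₀ = 1/4`, `n₀ = 0`; only the cut-side degree is used.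

No definitions. CONDITIONAL on Grigoriev 2001 Lemma 1.4 (not proved in the tree).
-/

set_option linter.dupNamespace false -- `Summit.PneNP.PneNP.…`: summit = sub-problem (D-0017)

namespace Summit.PneNP.PneNP.Theorems.ChebyshevTracialDesignJunta

open Finset Literature.Barriers.PneNP Literature.Combinatorics.SimpleGraph.CycleSpace
open Polynomial Literature.Computability.Complexity

variable {n : ℕ}

/-! ### Part I: low-degree cut-side factors have nonpositive design value (modulo Grigoriev's Lemma 1.4) -/

section LowDegree

open Matrix Literature.Combinatorics.Optimization
open scoped MatrixOrder

/-- `tr(A Aᵀ Y) = Σ_{j,a,b} Y(b,a) A(a,j) A(b,j)`. [folklore] -/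
theorem trace_mul_transpose_mul_eq {r m : ℕ} (A : Matrix (Fin r) (Fin m) ℝ) (Y : Matrix (Fin r) (Fin r) ℝ) :
    (A * Aᵀ * Y).trace = ∑ j, ∑ a, ∑ b, Y b a * (A a j * A b j) := by
  calc (A * Aᵀ * Y).trace = ∑ a, ∑ b, ∑ j, Y b a * (A a j * A b j) := by
        simp only [Matrix.trace, Matrix.diag_apply, Matrix.mul_apply, Matrix.transpose_apply, Finset.sum_mul]
        exact sum_congr rfl fun a _ => sum_congr rfl fun b _ => sum_congr rfl fun j _ => by ring
    _ = ∑ a, ∑ j, ∑ b, Y b a * (A a j * A b j) := sum_congr rfl fun a _ => Finset.sum_comm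
    _ = ∑ j, ∑ a, ∑ b, Y b a * (A a j * A b j) := Finset.sum_comm

/-- A real psd matrix is a Gram matrix: `Y(b,a) = Σ_l S(l,a) S(l,b)` for `S = √Y`. [folklore] -/
theorem exists_gram_of_posSemidef {r : ℕ} {Y : Matrix (Fin r) (Fin r) ℝ} (hY : Y.PosSemidef) :
    ∃ S : Matrix (Fin r) (Fin r) ℝ, ∀ a b, Y b a = ∑ l, S l a * S l b := by
  set S : Matrix (Fin r) (Fin r) ℝ := CFC.sqrt Y with hS
  have hSpsd : S.PosSemidef := (CFC.sqrt_nonneg Y).posSemidef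
  have hSS : S * S = Y := CFC.sqrt_mul_sqrt_self Y hY.nonneg
  have hSH : Sᴴ = S := hSpsd.1
  refine ⟨S, fun a b => ?_⟩
  rw [← hSS, Matrix.mul_apply]
  refine sum_congr rfl fun l _ => ?_
  have h1 : S b l = S l b := by
    have := congrFun (congrFun hSH l) b
    rw [conjTranspose_apply, star_trivial] at this
    exact this
  rw [h1]; ring

/-- Product of two containment indicators. [folklore] -/
theorem ite_subset_mul_ite_subset (A' A'' U : Finset (Fin n)) :
    (if A' ⊆ U then (1 : ℝ) else 0) * (if A'' ⊆ U then (1 : ℝ) else 0) = if A' ∪ A'' ⊆ U then 1 else 0 := by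
  by_cases h1 : A' ⊆ U <;> by_cases h2 : A'' ⊆ U <;> simp [h1, h2, union_subset_iff]

/-- Reordering a fourfold sum. [folklore] -/
theorem sum_comm_four {ι₁ ι₂ ι₃ ι₄ : Type*} [Fintype ι₁] [Fintype ι₂] [Fintype ι₃] [Fintype ι₄]
    (F : ι₁ → ι₂ → ι₃ → ι₄ → ℝ) :
    ∑ a, ∑ b, ∑ c, ∑ d, F a b c d = ∑ c, ∑ d, ∑ a, ∑ b, F a b c d := by
  calc ∑ a, ∑ b, ∑ c, ∑ d, F a b c d = ∑ a, ∑ c, ∑ b, ∑ d, F a b c d :=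
        sum_congr rfl fun a _ => Finset.sum_comm
    _ = ∑ a, ∑ c, ∑ d, ∑ b, F a b c d :=
        sum_congr rfl fun a _ => sum_congr rfl fun c _ => Finset.sum_comm
    _ = ∑ c, ∑ a, ∑ d, ∑ b, F a b c d := Finset.sum_comm
    _ = ∑ c, ∑ d, ∑ a, ∑ b, F a b c d := sum_congr rfl fun c _ => Finset.sum_comm

/-- **Low-degree sum law per matching** (cell pnp-psdrank ROUND-3 §2.14–2.15, one-sided): for a perfect
matching `M` of `K_n` (`N` edges), a family `A_U` of `r × m` matrices whose entries are combinations
`A_U(a,j) = Σ_{|A'| ≤ k} α(a,j,A')·1[A' ⊆ U]` of containment indicators, and a psd `Y`, the level sums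
`Σ_{U : c crossing, i internal} tr(A_U A_Uᵀ Y)` (`c + 2i = t`) equal `T(N; c, i)·P(c)` for a real
polynomial `P` of degree `≤ 2k` whose virtual value `P(0)` is a sum of Grigoriev knapsack forms, hence
`≥ 0` under Grigoriev's Lemma 1.4 (`2k ≤ N`, `k - 1 < t/2 < N - k + 1`). [cite: Grigoriev2001, Lemma 1.4 (PDF p. 8)] -/
theorem lowdeg_sum_law (hG : Grigoriev2001_knapsackFormNonneg) (M : PMatch n) {t k r m : ℕ}
    (hk : 2 * k ≤ M.1.card) (hr₁ : (k : ℝ) - 1 < (t : ℝ) / 2) (hr₂ : (t : ℝ) / 2 < (M.1.card : ℝ) - k + 1)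
    (α : Fin r → Fin m → {A' : Finset (Fin n) // A'.card ≤ k} → ℝ) (Y : Matrix (Fin r) (Fin r) ℝ)
    (hY : Y.PosSemidef) :
    ∃ P : Polynomial ℝ, P.natDegree ≤ 2 * k ∧ 0 ≤ P.eval 0 ∧ ∀ c i : ℕ, c + 2 * i = t →
      ∑ U ∈ (univ : Finset (Fin n)).powerset.filter (fun U =>
          (M.1.filter fun e => cutCount U e = 1).card = c ∧ (M.1.filter fun e => cutCount U e = 2).card = i),
        ∑ j, ∑ a, ∑ b, Y b a *
          ((∑ A' : {A' : Finset (Fin n) // A'.card ≤ k}, α a j A' * (if A'.1 ⊆ U then (1 : ℝ) else 0)) *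
           (∑ A'' : {A' : Finset (Fin n) // A'.card ≤ k}, α b j A'' * (if A''.1 ⊆ U then (1 : ℝ) else 0))) =
        ((M.1.card.choose (c + i) * (c + i).choose i * 2 ^ c : ℕ) : ℝ) * P.eval (c : ℝ) := by
  -- the index set of the containment events: (j, a, b, A', A'')
  obtain ⟨P, hPdeg, hP0, hPval⟩ := containment_comb_poly M t (2 * k)
    (σ := Fin m × Fin r × Fin r × {A' : Finset (Fin n) // A'.card ≤ k} × {A' : Finset (Fin n) // A'.card ≤ k})
    (fun s => Y s.2.2.1 s.2.1 * (α s.2.1 s.1 s.2.2.2.1 * α s.2.2.1 s.1 s.2.2.2.2))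
    (fun s => s.2.2.2.1.1 ∪ s.2.2.2.2.1)
    (fun s => by
      have h1 : (M.1.filter fun e => ∃ a ∈ s.2.2.2.1.1 ∪ s.2.2.2.2.1, a ∈ e).card ≤
          (s.2.2.2.1.1 ∪ s.2.2.2.2.1).card := by
        convert card_filter_meets_le M.2 (s.2.2.2.1.1 ∪ s.2.2.2.2.1) using 3
      have h2 := card_union_le s.2.2.2.1.1 s.2.2.2.2.1
      have h3 := s.2.2.2.1.2
      have h4 := s.2.2.2.2.2
      omega)
  refine ⟨P, hPdeg, ?_, fun c i hci => ?_⟩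
  · -- the virtual value is a sum of knapsack forms
    rw [hP0]
    obtain ⟨S, hS⟩ := exists_gram_of_posSemidef hY
    simp only [Fintype.sum_prod_type]
    refine sum_nonneg fun j _ => ?_
    rw [sum_comm_four]
    have hre : ∀ (A' A'' : {A' : Finset (Fin n) // A'.card ≤ k}),
        ∑ a, ∑ b, Y b a * (α a j A' * α b j A'') *
            knapsackMoment M.1.card ((t : ℝ) / 2) (M.1.filter fun e => ∃ x ∈ A'.1 ∪ A''.1, x ∈ e).card =
          ∑ l, (∑ a, S l a * α a j A') * (∑ b, S l b * α b j A'') *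
            knapsackMoment M.1.card ((t : ℝ) / 2) (M.1.filter fun e => ∃ x ∈ A'.1 ∪ A''.1, x ∈ e).card := by
      intro A' A''
      calc ∑ a, ∑ b, Y b a * (α a j A' * α b j A'') *
              knapsackMoment M.1.card ((t : ℝ) / 2) (M.1.filter fun e => ∃ x ∈ A'.1 ∪ A''.1, x ∈ e).card
          = ∑ a, ∑ b, ∑ l, (S l a * α a j A') * (S l b * α b j A'') *
              knapsackMoment M.1.card ((t : ℝ) / 2) (M.1.filter fun e => ∃ x ∈ A'.1 ∪ A''.1, x ∈ e).card := by
            refine sum_congr rfl fun a _ => sum_congr rfl fun b _ => ?_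
            rw [hS a b, sum_mul, sum_mul]
            exact sum_congr rfl fun l _ => by ring
        _ = ∑ a, ∑ l, ∑ b, (S l a * α a j A') * (S l b * α b j A'') *
              knapsackMoment M.1.card ((t : ℝ) / 2) (M.1.filter fun e => ∃ x ∈ A'.1 ∪ A''.1, x ∈ e).card :=
            sum_congr rfl fun a _ => Finset.sum_comm
        _ = ∑ l, ∑ a, ∑ b, (S l a * α a j A') * (S l b * α b j A'') *
              knapsackMoment M.1.card ((t : ℝ) / 2) (M.1.filter fun e => ∃ x ∈ A'.1 ∪ A''.1, x ∈ e).card :=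
            Finset.sum_comm
        _ = ∑ l, (∑ a, S l a * α a j A') * (∑ b, S l b * α b j A'') *
              knapsackMoment M.1.card ((t : ℝ) / 2) (M.1.filter fun e => ∃ x ∈ A'.1 ∪ A''.1, x ∈ e).card := by
            refine sum_congr rfl fun l _ => ?_
            rw [Finset.sum_mul_sum, Finset.sum_mul]
            refine sum_congr rfl fun a _ => ?_
            rw [Finset.sum_mul]
    rw [sum_congr rfl fun A' _ => sum_congr rfl fun A'' _ => hre A' A'']
    -- pull `Σ_l` outside
    rw [sum_congr rfl fun A' _ => Finset.sum_comm, Finset.sum_comm]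
    refine sum_nonneg fun l _ => ?_
    exact virtualForm_nonneg hG M hk hr₁ hr₂ (fun A' => ∑ a, S l a * α a j A')
  · -- the level sums: expand the trace form into containment events
    rw [← hPval c i hci]
    refine sum_congr rfl fun U _ => ?_
    simp only [Fintype.sum_prod_type]
    refine sum_congr rfl fun j _ => sum_congr rfl fun a _ => sum_congr rfl fun b _ => ?_
    rw [Finset.sum_mul_sum, mul_sum]
    refine sum_congr rfl fun A' _ => ?_
    rw [mul_sum]
    refine sum_congr rfl fun A'' _ => ?_
    rw [← ite_subset_mul_ite_subset]
    ring

end LowDegree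

section LowDegreeDesign

open Matrix Literature.Combinatorics.Optimization
open scoped MatrixOrder

/-- **Low-degree cut-side factors have nonpositive design value, modulo Grigoriev's Lemma 1.4** (cell
pnp-psdrank ROUND-3 §2.15, one-sided; the virtual-level PSD step is the named fact
`Literature.Computability.Complexity.Grigoriev2001_knapsackFormNonneg`, carried as a hypothesis, and the
SOS step `tr(A Aᵀ Y) = Σ_{j,l} q_{jl}²` is carried explicitly): for an exact design of degree `D` on the
`t`-cuts, factors `A_U` (`r × m`) of Johnson degree `≤ k` with `2k ≤ D`, `4k ≤ t`, and ARBITRARY psd `Y`,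
`Σ_U Σ_M levelWeight(U,M)·tr(A_U A_Uᵀ Y_M) ≤ 0`. [cite: Grigoriev2001, Lemma 1.4 (PDF p. 8)] -/
theorem sum_levelWeight_trace_nonpos_of_lowDegree (hG : Grigoriev2001_knapsackFormNonneg)
    {t T D : ℕ} {Bv : ℝ} {C : Finset ℕ} {w : ℕ → ℝ} (hdes : IsExactDesign n t T D Bv C w)
    {r m k : ℕ} (h2k : 2 * k ≤ D) (h4k : 4 * k ≤ t)
    (A : OddSet n → Matrix (Fin r) (Fin m) ℝ) (hA : IsLowDegreeU n k A)
    (Y : PMatch n → Matrix (Fin r) (Fin r) ℝ) (hYpsd : ∀ M, (Y M).PosSemidef) :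
    ∑ U, ∑ M, levelWeight n t C w U M * (A U * (A U)ᵀ * Y M).trace ≤ 0 := by
  obtain ⟨htodd, htn, hTt, hC, -, hexact, -⟩ := hdes
  -- coefficients of the low-degree entries
  have hα' : ∀ a j, ∃ c : {A' : Finset (Fin n) // A'.card ≤ k} → ℝ,
      ∑ A', c A' • (fun U : OddSet n => if A'.1 ⊆ U.1 then (1 : ℝ) else 0) = fun U => A U a j :=
    fun a j => (Submodule.mem_span_range_iff_exists_fun ℝ).1 (hA a j)
  choose α hα using hα'
  have hAeval : ∀ (U : OddSet n) a j,
      A U a j = ∑ A' : {A' : Finset (Fin n) // A'.card ≤ k}, α a j A' * (if A'.1 ⊆ U.1 then (1 : ℝ) else 0) := by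
    intro U a j
    have := congrFun (hα a j) U
    rw [Finset.sum_apply] at this
    rw [← this]
    exact sum_congr rfl fun A' _ => by rw [Pi.smul_apply, smul_eq_mul]
  have hXpsd : ∀ U : OddSet n, (A U * (A U)ᵀ).PosSemidef := fun U => by
    simpa [Matrix.conjTranspose_eq_transpose_of_trivial] using Matrix.posSemidef_self_mul_conjTranspose (A U)
  have htr : ∀ (U : OddSet n) (M : PMatch n), 0 ≤ (A U * (A U)ᵀ * Y M).trace := fun U M =>
    (show HasPsdFactorization (fun U M => (A U * (A U)ᵀ * Y M).trace) r from
      ⟨fun U => A U * (A U)ᵀ, Y, hXpsd, hYpsd, fun _ _ => rfl⟩).nonneg U M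
  -- Step 1: the value as level sums
  have hval : ∑ U, ∑ M, levelWeight n t C w U M * (A U * (A U)ᵀ * Y M).trace =
      ∑ c ∈ C, w c / ((Qset n t c).card : ℝ) *
        ∑ M : PMatch n, ∑ U : OddSet n,
          (if U.1.card = t ∧ cc U M = c then (A U * (A U)ᵀ * Y M).trace else 0) := by
    calc ∑ U, ∑ M, levelWeight n t C w U M * (A U * (A U)ᵀ * Y M).trace
        = ∑ U, ∑ M, ∑ c ∈ C, (if (U, M) ∈ Qset n t c then
            w c / ((Qset n t c).card : ℝ) * (A U * (A U)ᵀ * Y M).trace else 0) := by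
          refine sum_congr rfl fun U _ => sum_congr rfl fun M _ => ?_
          rw [levelWeight, sum_mul]
          exact sum_congr rfl fun c _ => by split_ifs <;> simp
      _ = ∑ U, ∑ c ∈ C, ∑ M, (if (U, M) ∈ Qset n t c then
            w c / ((Qset n t c).card : ℝ) * (A U * (A U)ᵀ * Y M).trace else 0) := sum_congr rfl fun U _ => sum_comm
      _ = ∑ c ∈ C, ∑ U, ∑ M, (if (U, M) ∈ Qset n t c then
            w c / ((Qset n t c).card : ℝ) * (A U * (A U)ᵀ * Y M).trace else 0) := sum_comm
      _ = ∑ c ∈ C, w c / ((Qset n t c).card : ℝ) *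
            ∑ M : PMatch n, ∑ U : OddSet n,
              (if U.1.card = t ∧ cc U M = c then (A U * (A U)ᵀ * Y M).trace else 0) := by
          refine sum_congr rfl fun c _ => ?_
          rw [mul_sum, sum_comm]
          refine sum_congr rfl fun M _ => ?_
          rw [mul_sum]
          refine sum_congr rfl fun U _ => ?_
          simp only [mem_Qset_iff]
          split_ifs <;> simp
  -- Step 2: per matching, the polynomial from the low-degree sum law
  have hN : ∀ M : PMatch n, M.1.card = n / 2 := fun M => by have := two_mul_card_pmatch M; omega
  have hP : ∀ M : PMatch n, ∃ P : Polynomial ℝ, P.natDegree ≤ D ∧ 0 ≤ P.eval 0 ∧ ∀ c i : ℕ, c + 2 * i = t →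
      ∑ U : OddSet n, (if U.1.card = t ∧ cc U M = c then (A U * (A U)ᵀ * Y M).trace else 0) =
        (((n / 2).choose (c + i) * (c + i).choose i * 2 ^ c : ℕ) : ℝ) * P.eval (c : ℝ) := by
    intro M
    have hMt : t + 1 ≤ M.1.card := by have := two_mul_card_pmatch M; omega
    have hk : 2 * k ≤ M.1.card := by omega
    have hr₁ : (k : ℝ) - 1 < (t : ℝ) / 2 := by
      have : (4 : ℝ) * k ≤ t := by exact_mod_cast h4k
      linarith
    have hr₂ : (t : ℝ) / 2 < (M.1.card : ℝ) - k + 1 := by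
      have h1 : (4 : ℝ) * k ≤ t := by exact_mod_cast h4k
      have h2 : (t : ℝ) + 1 ≤ M.1.card := by exact_mod_cast hMt
      linarith
    obtain ⟨P, hPdeg, hP0, hPval⟩ := lowdeg_sum_law hG M hk hr₁ hr₂ α (Y M) (hYpsd M)
    refine ⟨P, hPdeg.trans h2k, hP0, fun c i hci => ?_⟩
    rw [sum_oddSet_level_eq M hci (fun U => A U * (A U)ᵀ) Y, ← hN M, ← hPval c i hci]
    refine sum_congr rfl fun U' hU' => ?_
    have hodd : Odd U'.card := by
      obtain ⟨-, hc, hi⟩ := mem_filter.1 hU'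
      have h := card_eq_cr_add_two_mul_in M.2 (subset_univ U')
      rw [hc, hi, hci] at h
      exact h ▸ htodd
    rw [dif_pos hodd, trace_mul_transpose_mul_eq]
    refine sum_congr rfl fun j _ => sum_congr rfl fun a _ => sum_congr rfl fun b _ => ?_
    rw [hAeval ⟨U', hodd⟩ a j, hAeval ⟨U', hodd⟩ b j]
  choose P hPdeg hP0 hPval using hP
  -- Step 3: |Q_c| = #PM · T(n/2; c, i)
  have hQ : ∀ c i : ℕ, c + 2 * i = t → ((Qset n t c).card : ℝ) =
      (Fintype.card (PMatch n) : ℝ) * (((n / 2).choose (c + i) * (c + i).choose i * 2 ^ c : ℕ) : ℝ) := by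
    intro c i hci
    have e1 : ((Qset n t c).card : ℝ) =
        ∑ M : PMatch n, ∑ U : OddSet n, (if U.1.card = t ∧ cc U M = c then (1 : ℝ) else 0) := by
      rw [Qset, Finset.card_filter, Nat.cast_sum, Fintype.sum_prod_type, sum_comm]
      refine sum_congr rfl fun M _ => sum_congr rfl fun U _ => ?_
      split_ifs <;> simp
    have e2 : ∀ M : PMatch n, ∑ U : OddSet n, (if U.1.card = t ∧ cc U M = c then (1 : ℝ) else 0) =
        (((n / 2).choose (c + i) * (c + i).choose i * 2 ^ c : ℕ) : ℝ) := by
      intro M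
      have key := sum_oddSet_level_eq M hci (r := 1) (fun _ => 1) (fun _ => 1)
      simp only [Matrix.mul_one, trace_one, Fintype.card_fin, Nat.cast_one, dite_eq_ite] at key
      rw [key]
      have hodd : ∀ U' ∈ (univ : Finset (Fin n)).powerset.filter (fun U' =>
          (M.1.filter fun e => cutCount U' e = 1).card = c ∧ (M.1.filter fun e => cutCount U' e = 2).card = i),
          (if Odd U'.card then (1 : ℝ) else 0) = 1 := by
        intro U' hU'
        rw [mem_filter] at hU'
        have hc := card_eq_cr_add_two_mul_in M.2 (subset_univ U')
        rw [hU'.2.1, hU'.2.2, hci] at hc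
        rw [if_pos (hc ▸ htodd)]
      rw [sum_congr rfl hodd, sum_const, nsmul_eq_mul, mul_one, card_filter_cr_in_eq M.2, hN M]
    rw [e1, Fintype.sum_congr _ _ e2, sum_const, card_univ, nsmul_eq_mul]
  -- Step 4: assemble
  rw [hval]
  have hterm : ∀ c ∈ C, w c / ((Qset n t c).card : ℝ) *
      ∑ M : PMatch n, ∑ U : OddSet n,
        (if U.1.card = t ∧ cc U M = c then (A U * (A U)ᵀ * Y M).trace else 0) =
      (Fintype.card (PMatch n) : ℝ)⁻¹ * ∑ M : PMatch n, w c * (P M).eval (c : ℝ) := by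
    intro c hc
    obtain ⟨hcodd, -, hcT, hne⟩ := hC c hc
    have hct : c ≤ t := hcT.trans hTt
    obtain ⟨i, hi⟩ : ∃ i, c + 2 * i = t := by
      obtain ⟨a, ha⟩ := hcodd; obtain ⟨b, hb⟩ := htodd; exact ⟨b - a, by omega⟩
    have hQc := hQ c i hi
    have hQ0 : ((Qset n t c).card : ℝ) ≠ 0 := by exact_mod_cast (card_pos.2 hne).ne'
    have hT0 : (((n / 2).choose (c + i) * (c + i).choose i * 2 ^ c : ℕ) : ℝ) ≠ 0 := by
      intro h0; rw [h0, mul_zero] at hQc; exact hQ0 hQc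
    rw [sum_congr rfl fun M _ => hPval M c i hi, ← mul_sum, hQc, mul_sum, mul_sum, mul_sum]
    refine sum_congr rfl fun M _ => ?_
    field_simp
  rw [sum_congr rfl hterm, ← mul_sum, sum_comm]
  have hinner : ∀ M : PMatch n, ∑ c ∈ C, w c * (P M).eval (c : ℝ) = -(P M).eval 0 :=
    fun M => hexact (P M) (hPdeg M)
  rw [Fintype.sum_congr _ _ hinner]
  exact mul_nonpos_of_nonneg_of_nonpos (inv_nonneg.2 (Nat.cast_nonneg _))
    (by rw [sum_neg_distrib, neg_nonpos]; exact sum_nonneg fun M _ => hP0 M)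

/-- **`DesignValueNonposLowDegree` from Grigoriev's knapsack Lemma 1.4** (the tree's named statement
`Literature.Combinatorics.Optimization.DesignValueNonposLowDegree`, cell pnp-psdrank ROUND-3 §2.15, with
`c₀ = 1/4`, `n₀ = 0`; only the cut-side factor needs to be low-degree): conditional on the named fact
`Literature.Computability.Complexity.Grigoriev2001_knapsackFormNonneg` (Grigoriev 2001, Lemma 1.4, not
proved in the tree). [cite: Grigoriev2001, Lemma 1.4 (PDF p. 8)] -/
theorem designValueNonposLowDegree_of_knapsack (hG : Grigoriev2001_knapsackFormNonneg) :
    DesignValueNonposLowDegree := by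
  refine ⟨1 / 4, by norm_num, 0, ?_⟩
  intro n t T D Bv C w hdes _ k k' r m hkk hc₀ A B hA _
  -- the cut-side degree bounds
  have h2k : 2 * k ≤ D := by omega
  have h4k : 4 * k ≤ t := by
    have h1 : ((k + k' : ℕ) : ℝ) ≤ 1 / 4 * t := hc₀
    have h2 : (4 : ℝ) * k ≤ t := by push_cast at h1; linarith
    exact_mod_cast h2
  have hYpsd : ∀ M : PMatch n, (B M * (B M)ᵀ).PosSemidef := fun M => by
    simpa [Matrix.conjTranspose_eq_transpose_of_trivial] using Matrix.posSemidef_self_mul_conjTranspose (B M)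
  have hval := sum_levelWeight_trace_nonpos_of_lowDegree hG hdes h2k h4k A hA (fun M => B M * (B M)ᵀ) hYpsd
  -- `Σ_c w_c levelProfile(c) = (1/r) Σ_U Σ_M levelWeight · tr`
  rcases Nat.eq_zero_or_pos r with hr0 | hrpos
  · subst hr0
    have h0 : ∀ c, levelProfile n t 0 (fun U => A U * (A U)ᵀ) (fun M => B M * (B M)ᵀ) c = 0 := by
      intro c; rw [levelProfile]; simp
    rw [sum_congr rfl (fun c _ => by rw [h0 c, mul_zero]), sum_const_zero]
  have hr : (0 : ℝ) < r := by exact_mod_cast hrpos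
  have hlp : ∀ c ∈ C, w c * levelProfile n t r (fun U => A U * (A U)ᵀ) (fun M => B M * (B M)ᵀ) c =
      (1 / r) * (w c / ((Qset n t c).card : ℝ) *
        ∑ p ∈ Qset n t c, (A p.1 * (A p.1)ᵀ * (B p.2 * (B p.2)ᵀ)).trace) := by
    intro c _
    rw [levelProfile]
    field_simp
  rw [sum_congr rfl hlp, ← mul_sum]
  refine mul_nonpos_of_nonneg_of_nonpos (by positivity) ?_
  -- the bracket is exactly `Σ_U Σ_M levelWeight · tr`
  have hval' : ∑ c ∈ C, w c / ((Qset n t c).card : ℝ) *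
      ∑ p ∈ Qset n t c, (A p.1 * (A p.1)ᵀ * (B p.2 * (B p.2)ᵀ)).trace =
      ∑ U, ∑ M, levelWeight n t C w U M * (A U * (A U)ᵀ * (B M * (B M)ᵀ)).trace := by
    calc ∑ c ∈ C, w c / ((Qset n t c).card : ℝ) *
          ∑ p ∈ Qset n t c, (A p.1 * (A p.1)ᵀ * (B p.2 * (B p.2)ᵀ)).trace
        = ∑ c ∈ C, ∑ U, ∑ M, (if (U, M) ∈ Qset n t c then
            w c / ((Qset n t c).card : ℝ) * (A U * (A U)ᵀ * (B M * (B M)ᵀ)).trace else 0) := by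
          refine sum_congr rfl fun c _ => ?_
          rw [← sum_sum_ite_mem (Qset n t c) fun U M => (A U * (A U)ᵀ * (B M * (B M)ᵀ)).trace, mul_sum]
          refine sum_congr rfl fun U _ => ?_
          rw [mul_sum]
          refine sum_congr rfl fun M _ => ?_
          split_ifs <;> simp
      _ = ∑ U, ∑ c ∈ C, ∑ M, (if (U, M) ∈ Qset n t c then
            w c / ((Qset n t c).card : ℝ) * (A U * (A U)ᵀ * (B M * (B M)ᵀ)).trace else 0) := sum_comm
      _ = ∑ U, ∑ M, ∑ c ∈ C, (if (U, M) ∈ Qset n t c then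
            w c / ((Qset n t c).card : ℝ) * (A U * (A U)ᵀ * (B M * (B M)ᵀ)).trace else 0) :=
          sum_congr rfl fun U _ => sum_comm
      _ = ∑ U, ∑ M, levelWeight n t C w U M * (A U * (A U)ᵀ * (B M * (B M)ᵀ)).trace := by
          refine sum_congr rfl fun U _ => sum_congr rfl fun M _ => ?_
          rw [levelWeight, sum_mul]
          exact sum_congr rfl fun c _ => by split_ifs <;> simp
  rw [hval']
  exact hval

end LowDegreeDesign

end Summit.PneNP.PneNP.Theorems.ChebyshevTracialDesignJunta
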